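import Summits.AtomisticToContinuum.BoseEinsteinCondensation.Theorems.BECThomsonPrinciplePeriodicToDirichletDefs

/-!
# Negative lemmas for crux `PeriodicToDirichlet` (stmt-AtomisticToContinuum-9483):
# the SOFT un-rewarding schema behind stub `Unrewarding` is false (two-state landscape)

Supports (does not close) stmt-AtomisticToContinuum-9483 (crux `PeriodicToDirichlet`, route
`BECThomsonPrinciple`), line `reward-pays-the-wall`, residual stub `RewardPaysTheWall.Unrewarding`
(`Theorems/BECThomsonPrinciplePeriodicToDirichletDefs.lean`; the crux is `Unrewarding →
PeriodicToDirichlet` over the tree). Filed by the crux disprover (gen 4). Small-model fact, all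
`[folklore]`, sorry-free:

* `Landscape` (states / energy / occupation per `N`), `Landscape.R`, `.F`, `.BECAt`,
  `.SoftUnrewarding` — the abstract shape of `rewardedEnergy`, `rewardedInf`, `RewardedBoxBECAt` and
  of `Unrewarding` at one `(v, ρ)`; `boseLandscape v ρ`, `boseLandscape_becAt_iff`,
  `unrewarding_iff_soft : Unrewarding ↔ ∀ v adm, ∃ ρ₃ > 0, ∀ ρ ∈ (0,ρ₃), (boseLandscape v ρ).SoftUnrewarding`
  (definitional);
* `twoState` — per `N` a condensed state (energy `1`, occupation `N`) and an uncondensed one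
  (energy `0`, occupation `0`); `twoState_becAt` (anchors at EVERY `λ > 0` with every `c ≤ 1`),
  `twoState_not_becAt_zero`, `not_softUnrewarding_twoState`, `softUnrewarding_not_universal`.

READING. `twoState` enjoys every soft property a convexity/Griffiths argument can use (`E ≥ 0`,
`0 ≤ occ ≤ N`, `R_λ` affine in `λ`, `F_N` concave, `F_N(λ)/N → 0 = e₀ + λ(1 − 1)`, a rewarded upper
bound with `c = 1`, unique gapped rewarded minimisers, anchors for all `λ > 0`, occupation monotone
in `λ`) and has NO unrewarded condensation: its condensed state costs an `o(N)` but positive energy —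
the caricature of the gap/wall-type cost `N·O(L_N⁻²)` of flat condensation in the free Dirichlet
gas (where the unrewarded minimiser `∏ sin` happens to be `53%` flat). Hence `Unrewarding` is not a
consequence of soft structure ("δ-after-N both sides, concavity blind" as a theorem): a proof must
show that the unrewarded Dirichlet near-minimisers of THIS Hamiltonian are flat-condensed — for
`v ≠ 0`, flat-mode BEC itself. Nothing here refutes `Unrewarding`.
-/

noncomputable section

open MeasureTheory Filter
open scoped ENNReal NNReal

namespace Summit.AtomisticToContinuum.BoseEinsteinCondensation.Theorems.PeriodicToDirichlet.Negative

open Literature.MathematicalPhysics.QuantumManyBody.BoseGas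
open Summit.AtomisticToContinuum.BoseEinsteinCondensation.RewardPaysTheWall


/-- An abstract sequence of reward landscapes: states, energy, occupation of the rewarded mode.
[folklore] -/
structure Landscape where
  /-- states at particle number `N` -/
  S : ℕ → Type
  /-- energy -/
  E : (N : ℕ) → S N → ℝ≥0∞
  /-- occupation of the rewarded mode -/
  occ : (N : ℕ) → S N → ℝ≥0∞

namespace Landscape

/-- The rewarded functional `R_λ(s) = E(s) + λ(N − occ s)`. [folklore] -/
def R (X : Landscape) (N : ℕ) (lam : ℝ) (s : X.S N) : ℝ≥0∞ :=
  X.E N s + ENNReal.ofReal lam * ((N : ℝ≥0∞) - X.occ N s)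

/-- Its infimum `F_N(λ)`. [folklore] -/
def F (X : Landscape) (N : ℕ) (lam : ℝ) : ℝ≥0∞ :=
  ⨅ s : X.S N, X.R N lam s

/-- Rewarded condensation with constant `c` at reward `λ` (the shape of `RewardedBoxBECAt`).
[folklore] -/
def BECAt (X : Landscape) (lam c : ℝ) : Prop :=
  ∀ᶠ N : ℕ in atTop, ∃ δ : ℝ≥0∞, 0 < δ ∧
    ∀ s : X.S N, X.R N lam s ≤ X.F N lam + δ → ENNReal.ofReal (c * N) ≤ X.occ N s

/-- The soft un-rewarding schema (the shape of `Unrewarding` at one `(v, ρ)`). [folklore] -/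
def SoftUnrewarding (X : Landscape) : Prop :=
  ∀ c : ℝ, 0 < c → (∀ lam : ℝ, 0 < lam → X.BECAt lam c) → ∃ c' : ℝ, 0 < c' ∧ X.BECAt 0 c'

end Landscape

/-- The Bose-gas landscape at `(v, ρ)`: Dirichlet trial states in `Λ_{L_N(ρ)}`, energy, flat-mode
occupation. [folklore] -/
def boseLandscape (v : ℝ → ℝ≥0∞) (ρ : ℝ) : Landscape where
  S N := TrialState N (sideLength ρ N)
  E _ Ψ := energy v Ψ
  occ N Ψ := occupation N (boxConstantMode (sideLength ρ N)) Ψ.ψ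

/-- Its rewarded condensation is `RewardedBoxBECAt` (definitionally). [folklore] -/
theorem boseLandscape_becAt_iff (v : ℝ → ℝ≥0∞) (ρ lam c : ℝ) :
    (boseLandscape v ρ).BECAt lam c ↔ RewardedBoxBECAt v ρ lam c :=
  Iff.rfl

/-- **`Unrewarding` is the soft schema asserted for the Bose-gas landscapes** (definitionally).
[folklore] -/
theorem unrewarding_iff_soft :
    Unrewarding ↔ ∀ v : ℝ → ℝ≥0∞, IsRepulsiveFiniteRange v → ∃ ρ₃ : ℝ, 0 < ρ₃ ∧
      ∀ ρ : ℝ, 0 < ρ → ρ < ρ₃ → (boseLandscape v ρ).SoftUnrewarding :=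
  Iff.rfl

/-- The two-state landscape: `true` = condensed (energy `1`, occupation `N`), `false` =
uncondensed (energy `0`, occupation `0`). [folklore] -/
def twoState : Landscape where
  S _ := Bool
  E _ b := if b then 1 else 0
  occ N b := if b then N else 0

/-- Occupations of the two states. [folklore] -/
theorem twoState_occ (N : ℕ) : twoState.occ N true = N ∧ twoState.occ N false = 0 := by
  simp [twoState]

/-- Rewarded values of the two states. [folklore] -/
theorem twoState_R (N : ℕ) (lam : ℝ) :
    twoState.R N lam true = 1 ∧ twoState.R N lam false = ENNReal.ofReal lam * N := by
  simp [Landscape.R, twoState]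

/-- **Anchors hold in the two-state landscape** at every `λ > 0` with every `c ≤ 1`: once
`λN > 2` the uncondensed state is not a `1`-near-minimiser of `R_λ` (`F_N(λ) ≤ R_λ(true) = 1`).
[folklore] -/
theorem twoState_becAt {lam c : ℝ} (hlam : 0 < lam) (hc : c ≤ 1) : twoState.BECAt lam c := by
  have hev : ∀ᶠ N : ℕ in atTop, (2 : ℝ) < lam * N := by
    obtain ⟨N₀, hN₀⟩ := exists_nat_gt (2 / lam)
    filter_upwards [eventually_ge_atTop N₀] with N hN
    rw [div_lt_iff₀ hlam] at hN₀
    calc (2 : ℝ) < N₀ * lam := hN₀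
      _ ≤ N * lam := by gcongr
      _ = lam * N := mul_comm _ _
  filter_upwards [hev] with N hN
  refine ⟨1, one_pos, fun s hs => ?_⟩
  have hF : twoState.F N lam ≤ 1 := (iInf_le _ true).trans (twoState_R N lam).1.le
  cases s with
  | true =>
      rw [(twoState_occ N).1]
      calc ENNReal.ofReal (c * N) ≤ ENNReal.ofReal (N : ℝ) :=
            ENNReal.ofReal_le_ofReal (by nlinarith [N.cast_nonneg (α := ℝ)])
        _ = N := ENNReal.ofReal_natCast N
  | false =>
      exfalso
      rw [(twoState_R N lam).2] at hs
      have h2 : ENNReal.ofReal lam * N ≤ 2 := hs.trans (by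
        calc twoState.F N lam + 1 ≤ 1 + 1 := add_le_add hF le_rfl
          _ = 2 := one_add_one_eq_two)
      rw [← ENNReal.ofReal_natCast N, ← ENNReal.ofReal_mul hlam.le,
        show (2 : ℝ≥0∞) = ENNReal.ofReal 2 by simp, ENNReal.ofReal_le_ofReal_iff zero_le_two] at h2
      linarith

/-- **No unrewarded condensation in the two-state landscape**: at `λ = 0` the uncondensed state is
an exact minimiser (`R_0(false) = 0`) with occupation `0 < c'N`. [folklore] -/
theorem twoState_not_becAt_zero {c' : ℝ} (hc' : 0 < c') : ¬ twoState.BECAt 0 c' := by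
  intro h
  obtain ⟨N, hN, δ, hδ, hs⟩ := ((eventually_gt_atTop 0).and h).exists
  have h0 : twoState.R N 0 false = 0 := by rw [(twoState_R N 0).2]; simp
  have := hs false (by rw [h0]; exact bot_le)
  rw [(twoState_occ N).2, nonpos_iff_eq_zero, ENNReal.ofReal_eq_zero] at this
  have hpos : 0 < c' * N := mul_pos hc' (Nat.cast_pos.2 hN)
  linarith

/-- **The soft un-rewarding schema is false.** [folklore] -/
theorem not_softUnrewarding_twoState : ¬ twoState.SoftUnrewarding := by
  intro h
  obtain ⟨c', hc', h0⟩ := h 1 one_pos fun lam hlam => twoState_becAt hlam le_rfl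
  exact twoState_not_becAt_zero hc' h0

/-- Hence **`SoftUnrewarding` is not a theorem about landscapes**: any proof of `Unrewarding` uses
a property of the Bose-gas landscapes that `twoState` lacks. [folklore] -/
theorem softUnrewarding_not_universal : ¬ ∀ X : Landscape, X.SoftUnrewarding :=
  fun h => not_softUnrewarding_twoState (h twoState)


end Summit.AtomisticToContinuum.BoseEinsteinCondensation.Theorems.PeriodicToDirichlet.Negative

end
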